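import Literature.NumberTheory.EllipticCurves.Sprung2012.ColemanOrbitLayerTwoIndependenceProofs
import Literature.NumberTheory.EllipticCurves.Sprung2012.HondaOrbitRankOfFunctionalsProofs
import Literature.NumberTheory.EllipticCurves.Sprung2012.ColemanMapSurjectiveProofs
import HarnessLib

/-!
# Sprung 2012 — the cokernel of the joint Coleman map over `ℚ` from a Honda system alone

Assembly of the in-tree derivation of the COKERNEL HALF of the Kurihara–Pollack / Sprung exact sequence
`0 → H¹_Iw(T) → Λ ⊕ Λ → ℤ_p → 0` [cite: KuriharaPollack2007, Prop. 1.2] [cite: LeiSujatha2021, §3] in the tree's functional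
model (`H¹_Iw(T) = Hom(E(K_∞·K_v), ℤ_p)` with the `Λ`-action `lambdaSMul`, joint Coleman map `IsColemanPair`, Def. 5.9 of
[Sprung2012]) over `ℚ` at an odd prime `p` of good supersingular reduction (`p ∣ a_p`), with NO independence, rank or
surjectivity hypothesis: the only input is a Honda system (`IsHondaSystem`, Def. 7.1–7.2 of [Sprung2012]).

* `exists_layer_two_functionals_indep` (local, any base): for `z₀` with Coleman value `(α, β)`, `α ∈ Λˣ`, `β(0) ∈ ℤ_pˣ`, the
  layer `E(K_2·K_v)` carries `p²` functionals independent modulo `p` — the restricted orbit `(T^t • z₀)|₂`, `t < p² − p + 1`,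
  and the saturated `(T^{p²−p+1+i} • z₀)|₂ / p`, `i < p − 1` (`ColemanOrbitSecondGeneratorProofs`,
  `ColemanOrbitLayerTwoIndependenceProofs`).
* `exists_linearMap_isColemanPair_cokernel_of_hondaSystem_rat`: over `ℚ`, the joint Coleman map is a `Λ`-linear injection
  `J : H¹_Iw(T) → Λ²` with `T·Λ² ⊆ im J` and `length_𝔭 (Λ²/im J) = 0` for every prime `𝔭 ∌ T` — the rank input of
  `exists_linearMap_isColemanPair_cokernel_of_indep_rat` being supplied by the previous theorem for the functional `z₀` of
  `exists_isColemanPair_isUnit` (Prop. 7.3).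

References: [cite: Sprung2012, Lemma 2.3 (p. 1487), Def. 5.9 (p. 1495), Def. 7.1–7.2 and Prop. 7.3 (p. 1500)]
[cite: KuriharaPollack2007, Prop. 1.2] [cite: LeiSujatha2021, §3 (SES-KP)] [cite: Kobayashi2003, Thm. 6.2 (p. 23)].
-/

noncomputable section

open scoped Classical

open Polynomial Finset

namespace Literature.NumberTheory.EllipticCurves.Sprung2012

open Literature.NumberTheory.EllipticCurves Literature.NumberTheory.GaloisRepresentations ZpExtension
  Literature.NumberTheory.EllipticCurves.Kobayashi2003 Literature.NumberTheory.EllipticCurves.Sprung2017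

section Local

universe u

variable {K : Type u} [Field K] {p : ℕ} [Fact p.Prime] (κ : ZpExtension K p)
variable {E : Type u} [Field E] [Algebra K E] (ι : AlgebraicClosure K →ₐ[K] AlgebraicClosure E)
variable (W : WeierstrassCurve K)

variable {κ ι W}

/-! ## §1 The `p²` layer functionals, indexed by `Fin (p²−p+1) ⊕ Fin (p−1)` -/

/-- **`Hom(E(K_2·K_v), ℤ_p)` contains `p²` functionals independent modulo `p`, built from the Coleman orbit of `z₀`**
(`z₀` with Coleman value `(α, β)`, `α ∈ Λˣ`, `β(0) ∈ ℤ_pˣ`, `p ∣ a_p`, Honda system): the restrictions `(T^t • z₀)|₂`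
(`t < p² − p + 1`) and the saturated `y_i = (T^{p²−p+1+i} • z₀)|₂ / p` (`i < p − 1`).
[cite: Sprung2012, Lemma 2.3 (p. 1487), Def. 5.9 (p. 1495), Def. 7.1–7.2 and Prop. 7.3 (p. 1500)] -/
theorem exists_layer_two_functionals_indep {ap : ℤ} (hap : (p : ℤ) ∣ ap) {g : Field.absoluteGaloisGroup E}
    (hg : κ.IsTopGenerator (resGalOfEmb ι g)) {cneg : localPoints W E} {c : ℕ → localPoints W E}
    (hH : IsHondaSystem κ ι W ap g cneg c) {z₀ : localTowerPointsOfEmb κ ι W →+ ℤ_[p]} {α β : IwasawaAlgebra p}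
    (h₀ : IsColemanPair κ ι W ap g c z₀ α β) (hα : IsUnit α) (hβ : IsUnit (PowerSeries.constantCoeff β)) :
    ∃ w : Fin (p ^ 2 - p + 1) ⊕ Fin (p - 1) → (localLayerPointsOfEmb κ ι W 2 →+ ℤ_[p]),
      ∀ cf : Fin (p ^ 2 - p + 1) ⊕ Fin (p - 1) → ℤ_[p],
        (∀ y, (p : ℤ_[p]) ∣ ∑ t, cf t * w t y) → ∀ t, (p : ℤ_[p]) ∣ cf t := by
  obtain ⟨G₂, hG₂⟩ := exists_cyclotomic_sq_comp_eq_X_pow_add (p := p)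
  obtain ⟨E₁, hE₁⟩ := exists_cyclotomicOmega_one_eq_X_pow_add (p := p)
  choose y hy using fun i : Fin (p - 1) ↦
    exists_layer_functional_mul_eq_lambdaSMul_X_pow hap hg hH h₀ (k := p ^ 2 - p + 1 + (i : ℕ)) (Nat.le_add_right _ _)
  have hle := localLayerPointsOfEmb_le_localTowerPointsOfEmb κ ι W 2
  refine ⟨Sum.elim (fun t ↦ (lambdaSMul κ ι W hg ((PowerSeries.X : IwasawaAlgebra p) ^ (t : ℕ)) z₀).comp
    (AddSubgroup.inclusion hle)) y, fun cf hcf ↦ ?_⟩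
  obtain ⟨hlam, hmu⟩ := natCast_dvd_of_orbit_and_second_generators hap hg hH.2.1 h₀ hα hβ hG₂ hE₁ y hy
    (fun t ↦ cf (Sum.inl t)) (fun i ↦ cf (Sum.inr i)) fun x hx ↦ by
      have h := hcf ⟨x, hx⟩
      rw [Fintype.sum_sum_type] at h
      exact h
  intro t
  cases t with
  | inl t => exact hlam t
  | inr i => exact hmu i

/-- Transport of "independent modulo `q`" along a reindexing (plumbing). [cite: Sprung2012, Lemma 2.3 (p. 1487)] -/
private theorem dvd_of_indep_of_equiv {ι₁ ι₂ A R : Type*} [Fintype ι₁] [Fintype ι₂] [AddCommGroup A] [CommRing R]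
    (e : ι₁ ≃ ι₂) {q : R} {w : ι₂ → (A →+ R)} (hw : ∀ cf : ι₂ → R, (∀ y, q ∣ ∑ t, cf t * w t y) → ∀ t, q ∣ cf t)
    (cf : ι₁ → R) (hcf : ∀ y, q ∣ ∑ t, cf t * w (e t) y) (t : ι₁) : q ∣ cf t := by
  have h := hw (fun s ↦ cf (e.symm s)) (fun y ↦ ?_) (e t)
  · rwa [Equiv.symm_apply_apply] at h
  · rw [← Equiv.sum_comp e]
    simp only [Equiv.symm_apply_apply]
    exact hcf y

end Local

/-! ## §2 Over `ℚ`: the cokernel half of the Kurihara–Pollack sequence, unconditionally -/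

section Rat

open NumberField IsDedekindDomain

/-- **The joint Coleman map over `ℚ` at an odd good supersingular prime: `Λ`-linear, injective, `T·Λ² ⊆ image`, cokernel
of length `0` at every prime `𝔭 ∌ T` — from a Honda system alone.** This is the cokernel half of the Kurihara–Pollack /
Sprung exact sequence `0 → H¹_Iw(T) → Λ ⊕ Λ → ℤ_p → 0` in the tree's functional model, with no independence / rank /
surjectivity hypothesis left: the rank input of `exists_linearMap_isColemanPair_cokernel_of_indep_rat` is supplied by
`exists_layer_two_functionals_indep` for the functional `z₀` of `exists_isColemanPair_isUnit`.
[cite: Sprung2012, Prop. 7.3 (p. 1500), Def. 5.9 (p. 1495), Lemma 2.3 (p. 1487)] [cite: KuriharaPollack2007, Prop. 1.2]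
[cite: LeiSujatha2021, §3 (SES-KP)] -/
theorem exists_linearMap_isColemanPair_cokernel_of_hondaSystem_rat (W : WeierstrassCurve ℚ) [W.IsElliptic]
    [W.IsGloballyMinimal] (p : ℕ) [Fact p.Prime] (hp2 : p ≠ 2) (hgood : W.HasGoodReductionAtPrime p)
    (hap : (p : ℤ) ∣ W.frobeniusTrace p) (κ : ZpExtension ℚ p) {v : HeightOneSpectrum (𝓞 ℚ)} (hpv : (p : 𝓞 ℚ) ∈ v.asIdeal)
    {g : Field.absoluteGaloisGroup (v.adicCompletion ℚ)}
    (hg : κ.IsTopGenerator (resGalOfEmb (closureEmb (K := ℚ) (v.adicCompletion ℚ)) g))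
    {cneg : localPoints W (v.adicCompletion ℚ)} {c : ℕ → localPoints W (v.adicCompletion ℚ)}
    (hH : IsHondaSystem κ (closureEmb (K := ℚ) (v.adicCompletion ℚ)) W (W.frobeniusTrace p) g cneg c) :
    letI := moduleOfGenerator κ (closureEmb (K := ℚ) (v.adicCompletion ℚ)) W hg
    ∃ J : (localTowerPointsOfEmb κ (closureEmb (K := ℚ) (v.adicCompletion ℚ)) W →+ ℤ_[p]) →ₗ[IwasawaAlgebra p]
        IwasawaAlgebra p × IwasawaAlgebra p,
      (∀ z, IsColemanPair κ (closureEmb (K := ℚ) (v.adicCompletion ℚ)) W (W.frobeniusTrace p) g c z (J z).1 (J z).2) ∧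
      Function.Injective J ∧
      (∀ x y : IwasawaAlgebra p, ∃ z, J z = (PowerSeries.X * x, PowerSeries.X * y)) ∧
      ∀ 𝔭 : PrimeSpectrum (IwasawaAlgebra p), (PowerSeries.X : IwasawaAlgebra p) ∉ 𝔭.asIdeal →
        Module.lengthAt (IwasawaAlgebra p) ((IwasawaAlgebra p × IwasawaAlgebra p) ⧸ LinearMap.range J) 𝔭 = 0 := by
  have hp : p.Prime := Fact.out
  obtain ⟨z₀, Ls, Lf, hCP, hLs, hLf⟩ := exists_isColemanPair_isUnit W p hp2 hgood hap κ hpv _ hg hH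
  obtain ⟨w, hw⟩ := exists_layer_two_functionals_indep hap hg hH hCP hLs (PowerSeries.isUnit_iff_constantCoeff.mp hLf)
  have hsq : p ≤ p ^ 2 := by rw [sq]; exact Nat.le_mul_self p
  have m_eq : p ^ 2 = (p ^ 2 - p + 1) + (p - 1) := by
    have h1 := hp.one_le
    generalize p ^ 2 = q at hsq ⊢
    omega
  let e : Fin (p ^ 2) ≃ Fin (p ^ 2 - p + 1) ⊕ Fin (p - 1) := (finCongr m_eq).trans finSumFinEquiv.symm
  exact exists_linearMap_isColemanPair_cokernel_of_indep_rat W p hp2 hgood hap κ hpv hg hH (fun t ↦ w (e t))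
    fun cf hcf t ↦ dvd_of_indep_of_equiv e hw cf hcf t

end Rat

end Literature.NumberTheory.EllipticCurves.Sprung2012

end
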